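import Mathlib
import Summits.Ventures.PercRepro.TriangleCapNearRegularDefs

/-!
# PercRepro — THE NEAR-REGULAR WITNESS AND THE EXACT BOTTOM OF THE DEEP SUB-BAND ON THE BIPARTITE GRAPHS OF THE
BAND, `t ≥ D²`, EVERY `ℓ` (p3, gen 55; part 307)

The near-regular configuration of part 303 (`lfNest`, `rfNR`: the `D`-regular circulant on `m + m` with its `r`
diagonal pairs redirected to a new leaf plus `r` new pairs at a new non-neighbour — `(D^m, r)` on both sides, collision
count `2 (m D (D − 1) + r (r − 1))`, and `coll + 2 r (D − r) = 2 t (D − 1)`) is assembled into a graph of the band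
(`nearRegularWitness`): bipartite, triangle-free, `s` edges, `w` of degree `s − t`, every off-degree `≤ D`, a
non-neighbour of off-degree exactly `D`, and `2 j + 2 t (D − 1) = t (t − 1) + 2 φ_D(t)`.

**THEOREM** (`else_bottom_bipartite_exact`, `2 ≤ D ≤ m = ⌊t/D⌋`, `m + 1 ≤ ℓ`, `2 t ≤ s`): on `ℓ + 1 + (s − t)`
vertices every BIPARTITE graph of the band with every off-degree `≤ D` has `t (t − 1) + 2 φ_D(t) ≤ 2 j + 2 t (D − 1)`
(part 302), and the near-regular witness attains it.  So on the bipartite graphs the bottom of the deep sub-band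
`u = t − D` for `t ≥ D²` is EXACTLY `C(t,2) − t (D − 1) + r (D − r)`, `r = t mod D`, for every `ℓ` — the g54
conjecture's "else" branch, which fails for non-bipartite graphs (parts 301, 305).  Axioms: standard.
-/

namespace PercRepro

namespace TriangleCap

namespace C047

open Finset

/-- **THE NEAR-REGULAR WITNESS:** for `2 ≤ D ≤ m`, `r < D`, `t = m D + r`, `m + 1 ≤ ℓ`, `2 t ≤ s`, a bipartite
triangle-free graph on `ℓ + 1 + (s − t)` vertices with `s` edges, a vertex `w` of degree `s − t`, every off-degree
`≤ D`, a non-neighbour of off-degree exactly `D`, and the band value `2 j` with `2 j + 2 t (D − 1) = t (t − 1) + 2 φ_D(t)`. -/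
theorem nearRegularWitness (s ℓ m r D : ℕ) (hD : 2 ≤ D) (hDm : D ≤ m) (hr : r < D) (hmℓ : m + 1 ≤ ℓ)
    (hs : 2 * (m * D + r) ≤ s) :
    ∃ (H : SimpleGraph (Fin (ℓ + 1 + (s - (m * D + r))))) (_ : DecidableRel H.Adj), H.CliqueFree 3 ∧
      BipSub H (leftPart (ℓ + 1 + (s - (m * D + r))) (ℓ + 1)) ∧
      H.edgeFinset.card = s ∧ ∃ w, deg H w + (m * D + r) = s ∧ (∀ v, offDeg H w v ≤ D) ∧
        (∃ x, ¬ H.Adj w x ∧ offDeg H w x = D) ∧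
        ∃ j, ∑ v, deg H v * deg H v + 2 * ((m * D + r) * (s - (m * D + r) - 1)) + 2 * j = s * (s + 1) ∧
          2 * j + 2 * ((m * D + r) * (D - 1)) = (m * D + r) * (m * D + r - 1) + 2 * phiD D (m * D + r) := by
  set t := m * D + r with ht
  set n := ℓ + 1 + (s - t) with hn
  have hD0 : 0 < D := by omega
  have hm : 0 < m := by omega
  have hn0 : 0 < n := by omega
  have ht0 : 0 < t := by nlinarith
  have htℓ : t ≤ ℓ * D := by
    have : (m + 1) * D ≤ ℓ * D := Nat.mul_le_mul_right D hmℓ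
    rw [Nat.succ_mul] at this
    omega
  have hg := goodEnds_nr s ℓ m r D hD hDm hr hmℓ hs
  have hval := genWitness_missing_value n (ℓ + 1) s t hn0 (lfNest D) (rfNR ℓ m r D) hg (by omega) ht0 (by omega)
    (by omega)
  have hatt : ((range t).filter (fun i => rfNR ℓ m r D i < ℓ + 1 + (s - t))).card = t := by
    rw [filter_true_of_mem (fun i hi => by
      have := rfNR_bounds ℓ m r D i hm (by omega) (mem_range.mp hi)
      have : 2 * m ≤ m * D := by nlinarith
      omega), card_range]
  have hcl := coll_lfNest m r D hD0 hr
  have hcr := coll_rfNR ℓ m r D hD0 hDm hr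
  rw [← ht] at hcl hcr
  rw [hatt, Nat.sub_self, mul_zero, zero_add, hcl, hcr] at hval
  have hphi : phiD D t = r * (D - r) := by
    unfold phiD
    have : t % D = r := by
      rw [ht, Nat.add_comm, Nat.add_mul_mod_self_right, Nat.mod_eq_of_lt hr]
    rw [this]
  have hid := nr_coll_add_phi m r D hr
  rw [← ht] at hid
  -- `P = 2 (m D (D − 1) + r (r − 1)) ≤ t (t − 1)`: `2 t (D − 1) ≤ t (t − 1)` as `2 D − 1 ≤ t`
  have hP : m * (D * (D - 1)) + r * (r - 1) + (m * (D * (D - 1)) + r * (r - 1)) ≤ t * (t - 1) := by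
    have h1 : 2 * (D - 1) ≤ t - 1 := by
      have : D * D ≤ m * D := Nat.mul_le_mul_right D hDm
      have hDD : 2 * D ≤ D * D + 1 := by nlinarith
      omega
    have h2 : t * (2 * (D - 1)) ≤ t * (t - 1) := Nat.mul_le_mul_left t h1
    have h3 : t * (2 * (D - 1)) = 2 * (t * (D - 1)) := by ring
    omega
  refine ⟨_, inferInstance, cliqueFree_of_bipSub _ _ (bipSub_missingGraph _ _), bipSub_missingGraph _ _,
    card_edges_missingGraph_genWitness n (ℓ + 1) s t hn0 (lfNest D) (rfNR ℓ m r D) hg (by omega) (by omega)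
      (by omega), fin' n hn0 0, ?_, ?_, ?_, ?_⟩
  · rw [deg_missingGraph_genWitness_zero n (ℓ + 1) s t hn0 (lfNest D) (rfNR ℓ m r D) hg (by omega) (by omega)]
    omega
  · intro v
    have hv : v = fin' n hn0 v.val := Fin.ext (by rw [fin'_val n hn0 v.val v.isLt])
    rw [hv]
    by_cases hva : v.val < ℓ + 1
    · rw [offDeg_genWitness_left n (ℓ + 1) s t hn0 (lfNest D) (rfNR ℓ m r D) hg (by omega) v.val hva]
      by_cases hv1 : 1 ≤ v.val
      · obtain ⟨a, ha⟩ : ∃ a, v.val = 1 + a := ⟨v.val - 1, by omega⟩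
        rw [ha, cls_lfNest t D a hD0]
        exact min_le_left _ _
      · rw [card_eq_zero.mpr (filter_eq_empty_iff.mpr (fun i hi hv' => by
          rw [mem_range] at hi
          have := lfNest_bounds t ℓ D i hD0 htℓ hi
          omega))]
        omega
    · rw [offDeg_genWitness_right n (ℓ + 1) s t hn0 (lfNest D) (rfNR ℓ m r D) hg (by omega) v.val (by omega)
        v.isLt]
      by_cases hvb : v.val < ℓ + 1 + m
      · obtain ⟨b, hb⟩ : ∃ b, v.val = ℓ + 1 + b := ⟨v.val - (ℓ + 1), by omega⟩
        rw [hb, cls_rfNR_old ℓ m r D b hD0 hDm hr (by omega)]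
      · by_cases hvm : v.val = ℓ + 1 + m
        · rw [hvm, cls_rfNR_new ℓ m r D hD0 hDm hr]
          omega
        · rw [card_eq_zero.mpr (filter_eq_empty_iff.mpr (fun i hi hv' => by
            have := rfNR_bounds ℓ m r D i hm (by omega) (mem_range.mp hi)
            omega))]
          omega
  · refine ⟨fin' n hn0 1, not_adj_genWitness_one n (ℓ + 1) s t hn0 (lfNest D) (rfNR ℓ m r D) (by omega)
      (by omega), ?_⟩
    rw [offDeg_genWitness_left n (ℓ + 1) s t hn0 (lfNest D) (rfNR ℓ m r D) hg (by omega) 1 (by omega)]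
    have := cls_lfNest_full m r D 0 hD0 hm
    rw [add_zero, ← ht] at this
    exact this
  · refine ⟨(t * (t - 1) - (m * (D * (D - 1)) + r * (r - 1) + (m * (D * (D - 1)) + r * (r - 1)))) / 2, ?_, ?_⟩
    · have heven : 2 ∣ t * (t - 1) - (m * (D * (D - 1)) + r * (r - 1) + (m * (D * (D - 1)) + r * (r - 1))) := by
        have h1 : 2 ∣ t * (t - 1) := by
          rcases Nat.even_or_odd t with h | h
          · exact Dvd.dvd.mul_right (even_iff_two_dvd.mp h) _
          · have : Even (t - 1) := by
              obtain ⟨k, hk⟩ := h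
              exact ⟨k, by omega⟩
            exact Dvd.dvd.mul_left (even_iff_two_dvd.mp this) _
        have h2 : 2 ∣ m * (D * (D - 1)) + r * (r - 1) + (m * (D * (D - 1)) + r * (r - 1)) :=
          ⟨m * (D * (D - 1)) + r * (r - 1), by ring⟩
        exact Nat.dvd_sub h1 h2
      rw [Nat.mul_div_cancel' heven]
      exact hval
    · have heven : 2 ∣ t * (t - 1) - (m * (D * (D - 1)) + r * (r - 1) + (m * (D * (D - 1)) + r * (r - 1))) := by
        have h1 : 2 ∣ t * (t - 1) := by
          rcases Nat.even_or_odd t with h | h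
          · exact Dvd.dvd.mul_right (even_iff_two_dvd.mp h) _
          · have : Even (t - 1) := by
              obtain ⟨k, hk⟩ := h
              exact ⟨k, by omega⟩
            exact Dvd.dvd.mul_left (even_iff_two_dvd.mp this) _
        have h2 : 2 ∣ m * (D * (D - 1)) + r * (r - 1) + (m * (D * (D - 1)) + r * (r - 1)) :=
          ⟨m * (D * (D - 1)) + r * (r - 1), by ring⟩
        exact Nat.dvd_sub h1 h2
      rw [Nat.mul_div_cancel' heven, hphi]
      omega

/-- **THE EXACT BOTTOM OF THE DEEP SUB-BAND ON THE BIPARTITE GRAPHS OF THE BAND, `t ≥ D²`, EVERY `ℓ`:** for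
`2 ≤ D ≤ m`, `t = m D + r`, `r < D`, `m + 1 ≤ ℓ`, `2 t ≤ s`: every bipartite graph on `ℓ + 1 + (s − t)` vertices with
a vertex of degree `s − t` and every off-degree `≤ D` has `t (t − 1) + 2 φ_D(t) ≤ 2 j + 2 t (D − 1)`, and the
near-regular witness attains it with maximum off-degree exactly `D` — the bottom is
`C(t,2) − t (D − 1) + r (D − r)`. -/
theorem else_bottom_bipartite_exact (s ℓ m r D : ℕ) (hD : 2 ≤ D) (hDm : D ≤ m) (hr : r < D) (hmℓ : m + 1 ≤ ℓ)
    (hs : 2 * (m * D + r) ≤ s) :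
    (∀ (H : SimpleGraph (Fin (ℓ + 1 + (s - (m * D + r))))) [DecidableRel H.Adj], H.CliqueFree 3 →
      (∃ A, BipSub H A) → H.edgeFinset.card = s → ∀ w, deg H w + (m * D + r) = s →
      (∀ v, offDeg H w v ≤ D) →
      ∀ j, ∑ v, deg H v * deg H v + 2 * ((m * D + r) * (s - (m * D + r) - 1)) + 2 * j = s * (s + 1) →
      (m * D + r) * (m * D + r - 1) + 2 * phiD D (m * D + r) ≤ 2 * j + 2 * ((m * D + r) * (D - 1))) ∧
    (∃ (H : SimpleGraph (Fin (ℓ + 1 + (s - (m * D + r))))) (_ : DecidableRel H.Adj), H.CliqueFree 3 ∧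
      BipSub H (leftPart (ℓ + 1 + (s - (m * D + r))) (ℓ + 1)) ∧
      H.edgeFinset.card = s ∧ ∃ w, deg H w + (m * D + r) = s ∧ (∀ v, offDeg H w v ≤ D) ∧
        (∃ x, ¬ H.Adj w x ∧ offDeg H w x = D) ∧
        ∃ j, ∑ v, deg H v * deg H v + 2 * ((m * D + r) * (s - (m * D + r) - 1)) + 2 * j = s * (s + 1) ∧
          2 * j + 2 * ((m * D + r) * (D - 1)) = (m * D + r) * (m * D + r - 1) + 2 * phiD D (m * D + r)) := by
  refine ⟨fun H _ hfree hbip hsH w hw hD' j hj => ?_, nearRegularWitness s ℓ m r D hD hDm hr hmℓ hs⟩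
  obtain ⟨A, hA⟩ := hbip
  have hw1 : 1 ≤ deg H w := by
    have : 0 < m * D := Nat.mul_pos (by omega) (by omega)
    omega
  exact band_ge_two_phi_of_bipSub H hfree s (m * D + r) j D hsH w hw hw1 hj hD' A hA

end C047

end TriangleCap

end PercRepro
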